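import Summits.ResolutionOfSingularities.ResolutionOfSingularities.Theorems.LossEntryW19
import HarnessLib

/-!
# LossEntryW20 (= lens-3 g29 slice 12) — walk plumbing of the loss→entry law — FRAME INDEPENDENCE at a twisted wall state

decomp-res-lens-3, gen 29 (NODE-g29 §3ter (S3)).  TOOL at 0.  Imports `Theorems.LossEntryW19` (§31).

§32 — FRAME INDEPENDENCE AT A TWISTED WALL STATE (NODE-g29 §3ter (S3)): `toLex_resPoint_le_of_partner` (a line partner with no larger
ceiling exponent gives a lexicographically smaller-or-equal point: same abscissa numerator, no smaller denominator, equal denominators ⇒ equal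
points), **`vertexOf_polyPts_eq_of_lineDom`** (two equations over one wall `(r a) e_a`, read in the frames `(a; b, c)` and `(a; c, b)`, whose
supports dominate each other along the lines `(E a, |E|)` — `ShearDom`-shape — have point sets with THE SAME LEX-MIN VERTEX, provided the first
reading is non-empty with no point on the axis `x = 0`), and **`vertexOf_polyPts_two_frames`** / `betaOf_polyPts_two_frames`: for `ν·λ = 1` and ANY
`F`, `vertexOf (polyPts s r a c b (clean (σ_{b,c,ν} F))) = vertexOf (polyPts s r a b c (clean (σ_{c,b,λ} F)))` (hence the same `ŷ`, `x̂`), the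
domination being `LossShearX2Line.shearDom_of_mul_eq_one` with `(i,j,l) := (a,b,c)` (Lucas granted).  So a twisted wall state (`L_v = u_c − λ_v u_b`
on the wall, `λ_v ≠ 0`) may be read in either frame: this glues the β-step law (whose target frame is `(b; a, c)`) to a next step wanting the frame
`(b; c, a)`, and reduces chart-`c` repeats to chart-`b` repeats.  The only non-structural hypothesis, «no axis point» (`E′ c < s → r a < E′ a`), is the
layer of the wall state (wall monomials straighten into the ceiling column).
-/

open MvPolynomial Finset
open Literature.AlgebraicGeometry.Resolution
open Literature.AlgebraicGeometry.Resolution.Hauser2010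
open Literature.AlgebraicGeometry.Resolution.PointBlowup
open Summit.ResolutionOfSingularities.ResolutionOfSingularities.Theorems.TightDefectClasses
open Summit.ResolutionOfSingularities.ResolutionOfSingularities.Theorems.TightDefectStrongWalks
open Summit.ResolutionOfSingularities.ResolutionOfSingularities.Theorems.ItineraryCutClasses
open Summit.ResolutionOfSingularities.ResolutionOfSingularities.Theorems.BoundaryLedger
open Summit.ResolutionOfSingularities.ResolutionOfSingularities.Theorems.ProximityCut
open Summit.ResolutionOfSingularities.ResolutionOfSingularities.Theorems.LossExitCone
open Summit.ResolutionOfSingularities.ResolutionOfSingularities.Theorems.LossPolygon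

/-! ## §32 FRAME INDEPENDENCE AT A TWISTED WALL STATE (NODE-g29 §3ter (S3)): the two straightenings `σ_{c,b,λ}` (frame `(a; b, c)`) and `σ_{b,c,ν}` (frame `(a; c, b)`), `νλ = 1`, have the same lex-min vertex -/

namespace Summit.ResolutionOfSingularities.ResolutionOfSingularities.Theorems.LossPolygon

variable {K : Type} [Field K]

section FrameDom

variable {a b c : Fin 3}

/-- Partner comparison between the two frames of one wall: if `P` (read in frame `(a; b, c)`, ceiling `c`) lies on the line of `D`
(read in frame `(a; c, b)`, ceiling `b`) — same `a`-exponent, same degree — with `P c ≤ D b < s`, and `D` is off the axis (`r a < D a`),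
then the point of `P` is lexicographically below the point of `D`: same abscissa numerator `D a − r a > 0`, denominator `s − P c ≥ s − D b`,
and equal denominators force equal points. [new; elementary] -/
theorem toLex_resPoint_le_of_partner (hab : a ≠ b) (hac : a ≠ c) (hbc : b ≠ c) {s : ℕ} {r : Fin 3 →₀ ℕ}
    (hrb : r b = 0) (hrc : r c = 0) {D P : Fin 3 →₀ ℕ} (hPa : P a = D a) (hdeg : P.degree = D.degree) (hle : P c ≤ D b)
    (hDb : D b < s) (hMa : r a < D a) :
    toLex (resPoint s r a b c P) ≤ toLex (resPoint s r a c b D) := by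
  have h1 := degree_fin3 hab hac hbc P
  have h2 := degree_fin3 hab hac hbc D
  have hPb : P b + P c = D b + D c := by omega
  have hxP : (resPoint s r a b c P).1 = ((((D a : ℕ) : ℚ)) - r a) / (((s : ℕ) : ℚ) - P c) := by
    show ((((P a : ℕ) : ℚ)) - r a) / (((s : ℕ) : ℚ) + r c - P c) = _
    rw [hPa, hrc, Nat.cast_zero, add_zero]
  have hyP : (resPoint s r a b c P).2 = (((P b : ℕ) : ℚ)) / (((s : ℕ) : ℚ) - P c) := by
    show ((((P b : ℕ) : ℚ)) - r b) / (((s : ℕ) : ℚ) + r c - P c) = _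
    rw [hrb, hrc, Nat.cast_zero, add_zero, sub_zero]
  have hxD : (resPoint s r a c b D).1 = ((((D a : ℕ) : ℚ)) - r a) / (((s : ℕ) : ℚ) - D b) := by
    show ((((D a : ℕ) : ℚ)) - r a) / (((s : ℕ) : ℚ) + r b - D b) = _
    rw [hrb, Nat.cast_zero, add_zero]
  have hyD : (resPoint s r a c b D).2 = (((D c : ℕ) : ℚ)) / (((s : ℕ) : ℚ) - D b) := by
    show ((((D c : ℕ) : ℚ)) - r c) / (((s : ℕ) : ℚ) + r b - D b) = _
    rw [hrb, hrc, Nat.cast_zero, add_zero, sub_zero]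
  have hN : (0 : ℚ) < (((D a : ℕ) : ℚ)) - r a := by
    have : ((r a : ℕ) : ℚ) < D a := by exact_mod_cast hMa
    linarith
  have hd : (0 : ℚ) < ((s : ℕ) : ℚ) - D b := by
    have : ((D b : ℕ) : ℚ) < s := by exact_mod_cast hDb
    linarith
  rw [toLex_le_toLex_iff, hxP, hyP, hxD, hyD]
  rcases Nat.eq_or_lt_of_le hle with h | h
  · -- equal denominators: the two points coincide
    right
    have hPb' : P b = D c := by omega
    rw [h, hPb']
    exact ⟨rfl, le_rfl⟩
  · -- strictly larger denominator and positive numerator: strictly smaller abscissa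
    left
    have hdd : ((s : ℕ) : ℚ) - D b < ((s : ℕ) : ℚ) - P c := by
      have : ((P c : ℕ) : ℚ) < D b := by exact_mod_cast h
      linarith
    exact div_lt_div_of_pos_left hN hd hdd

/-- **FRAME INDEPENDENCE UNDER LINE DOMINATION (PROVED; NODE-g29 §3ter (S3)).**  Two equations `G₁` (read in frame `(a; b, c)`) and `G₂`
(read in frame `(a; c, b)`) over one wall `r = (r a) e_a` whose supports dominate each other along the lines `(E a, |E|)` — every
`E ∈ supp G₂` below its ceiling (`E b < s`) has a partner `E′ ∈ supp G₁` with `E′ c ≤ E b`, and every `E′ ∈ supp G₁` below its ceiling has a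
partner `E ∈ supp G₂` with `E b ≤ E′ c` (this is `ShearDom`, W04/`LossShearX2`) — have point sets with THE SAME LEX-MIN VERTEX, provided
frame 1 has no point on the axis `x = 0` (`E′ c < s → r a < E′ a`: the layer of a wall state straightens into the ceiling column) and is
non-empty.  [new] -/
theorem vertexOf_polyPts_eq_of_lineDom (hab : a ≠ b) (hac : a ≠ c) (hbc : b ≠ c) {s : ℕ} {r : Fin 3 →₀ ℕ}
    (hrb : r b = 0) (hrc : r c = 0) {G₁ G₂ : MvPolynomial (Fin 3) K}
    (h12 : ∀ E ∈ G₂.support, E b < s → ∃ E' ∈ G₁.support, E' a = E a ∧ E'.degree = E.degree ∧ E' c ≤ E b)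
    (h21 : ∀ E' ∈ G₁.support, E' c < s → ∃ E ∈ G₂.support, E a = E' a ∧ E.degree = E'.degree ∧ E b ≤ E' c)
    (hax : ∀ E' ∈ G₁.support, E' c < s → r a < E' a) (hne : (polyPts s r a b c G₁).Nonempty) :
    (polyPts s r a c b G₂).Nonempty ∧ vertexOf (polyPts s r a c b G₂) = vertexOf (polyPts s r a b c G₁) := by
  classical
  have hA : ∀ x ∈ polyPts s r a c b G₂, ∃ y ∈ polyPts s r a b c G₁, toLex y ≤ toLex x := by
    intro x hx
    obtain ⟨E, hE, rfl⟩ := Finset.mem_image.mp hx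
    obtain ⟨hEG, hEb⟩ := Finset.mem_filter.mp hE
    have hEb' : E b < s := by rw [hrb, add_zero] at hEb; exact hEb
    obtain ⟨E', hE'G, hE'a, hE'deg, hE'c⟩ := h12 E hEG hEb'
    have hE'c' : E' c < s := lt_of_le_of_lt hE'c hEb'
    have hMa : r a < E a := by rw [← hE'a]; exact hax E' hE'G hE'c'
    refine ⟨resPoint s r a b c E', Finset.mem_image_of_mem _ (Finset.mem_filter.mpr ⟨hE'G, by rw [hrc, add_zero]; exact hE'c'⟩), ?_⟩
    exact toLex_resPoint_le_of_partner hab hac hbc hrb hrc hE'a hE'deg hE'c hEb' hMa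
  have hB : ∀ y ∈ polyPts s r a b c G₁, ∃ x ∈ polyPts s r a c b G₂, toLex x ≤ toLex y := by
    intro y hy
    obtain ⟨E', hE', rfl⟩ := Finset.mem_image.mp hy
    obtain ⟨hE'G, hE'c⟩ := Finset.mem_filter.mp hE'
    have hE'c' : E' c < s := by rw [hrc, add_zero] at hE'c; exact hE'c
    obtain ⟨E, hEG, hEa, hEdeg, hEb⟩ := h21 E' hE'G hE'c'
    have hEb' : E b < s := lt_of_le_of_lt hEb hE'c'
    have hMa : r a < E' a := hax E' hE'G hE'c'
    refine ⟨resPoint s r a c b E, Finset.mem_image_of_mem _ (Finset.mem_filter.mpr ⟨hEG, by rw [hrb, add_zero]; exact hEb'⟩), ?_⟩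
    exact toLex_resPoint_le_of_partner hac hab hbc.symm hrc hrb hEa hEdeg hEb hE'c' hMa
  obtain ⟨y, hy⟩ := hne
  obtain ⟨x, hx, -⟩ := hB y hy
  exact ⟨⟨x, hx⟩, vertexOf_eq_of_dom ⟨x, hx⟩ ⟨y, hy⟩ hA hB⟩

variable {q : ℕ}

/-- **FRAME INDEPENDENCE OF THE STRAIGHTENED WALL POLYGON (PROVED; NODE-g29 §3ter (S3)).**  For `ν·λ = 1` and ANY equation `F`: the
`σ_{b,c,ν}`-straightened, re-cleaned equation read in frame `(a; c, b)` and the `σ_{c,b,λ}`-straightened, re-cleaned equation read in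
frame `(a; b, c)` have the same lex-min vertex (hence the same `x̂` and `ŷ`), provided the latter reading is non-empty and has no point on
the axis `x = 0`.  The domination is `LossShearX2Line.shearDom_of_mul_eq_one` (Lucas granted); a twisted wall state (`L_v = u_c − λ u_b`
on the wall, `λ ≠ 0`) may therefore be read in either frame. [new] -/
theorem vertexOf_polyPts_two_frames (hab : a ≠ b) (hac : a ≠ c) (hbc : b ≠ c) {s : ℕ} {r : Fin 3 →₀ ℕ}
    (hrb : r b = 0) (hrc : r c = 0) {ν lam : K} (hνl : ν * lam = 1)
    (hLucas : ∀ D T : ℕ, q ∣ D → ¬ q ∣ T → ((D.choose T : ℕ) : K) = 0) (F : MvPolynomial (Fin 3) K)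
    (hax : ∀ E' ∈ (deletePthPowers q (shear c b lam F)).support, E' c < s → r a < E' a)
    (hne : (polyPts s r a b c (deletePthPowers q (shear c b lam F))).Nonempty) :
    (polyPts s r a c b (deletePthPowers q (shear b c ν F))).Nonempty ∧
      vertexOf (polyPts s r a c b (deletePthPowers q (shear b c ν F))) =
        vertexOf (polyPts s r a b c (deletePthPowers q (shear c b lam F))) := by
  obtain ⟨h12, h21⟩ := shearDom_of_mul_eq_one hab hac.symm hbc.symm hνl hLucas s F
  exact vertexOf_polyPts_eq_of_lineDom hab hac hbc hrb hrc (fun E hE hEb => h12 E hE hEb) (fun E' hE' hE'c => h21 E' hE' hE'c) hax hne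

/-- Corollary: same ordinate `ŷ` and abscissa `x̂` in the two frames. [new] -/
theorem betaOf_polyPts_two_frames (hab : a ≠ b) (hac : a ≠ c) (hbc : b ≠ c) {s : ℕ} {r : Fin 3 →₀ ℕ}
    (hrb : r b = 0) (hrc : r c = 0) {ν lam : K} (hνl : ν * lam = 1)
    (hLucas : ∀ D T : ℕ, q ∣ D → ¬ q ∣ T → ((D.choose T : ℕ) : K) = 0) (F : MvPolynomial (Fin 3) K)
    (hax : ∀ E' ∈ (deletePthPowers q (shear c b lam F)).support, E' c < s → r a < E' a)
    (hne : (polyPts s r a b c (deletePthPowers q (shear c b lam F))).Nonempty) :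
    betaOf (polyPts s r a c b (deletePthPowers q (shear b c ν F))) = betaOf (polyPts s r a b c (deletePthPowers q (shear c b lam F))) ∧
      alphaOf (polyPts s r a c b (deletePthPowers q (shear b c ν F))) =
        alphaOf (polyPts s r a b c (deletePthPowers q (shear c b lam F))) := by
  have h := (vertexOf_polyPts_two_frames hab hac hbc hrb hrc hνl hLucas F hax hne).2
  unfold betaOf alphaOf
  rw [h]
  exact ⟨rfl, rfl⟩

end FrameDom

end Summit.ResolutionOfSingularities.ResolutionOfSingularities.Theorems.LossPolygon
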